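import Mathlib
import Summits.Schanuel.Schanuel.Theorems.AclSubsetLogFreeCore.Negative.ExpAclField
import Summits.Schanuel.Schanuel.Theorems.AclSubsetLogFreeCore.Negative.ExpAclDefinability
import Literature.ModelTheory.ExponentialFields.DefinabilityParams

/-!
# The ONE-SIDED COSET SELECTOR — crux stmt-Schanuel-0969 `RigidCore.MinimalCounterexampleInAcl`

Line `kernel-arithmetic-selection` (gen 12), `--supports stmt-Schanuel-0969`, stub `stub_selectorOneSided`.

Let `E ⊆ ℂ` be `∅`-definable in `ℂ_exp = (ℂ, +, ·, −, 0, 1, exp)` with `exp '' E` finite (so `E` lies on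
finitely many cosets of the kernel `2πiℤ`), and let `u ∈ E`.  If the hit set `K = {k : ℤ | u + 2πik ∈ E}` of
`u`'s coset is bounded below or bounded above, then `u ∈ acl^{ℂ_exp}(∅) = expAcl`.

Proof.  `ℂ_exp` sees the ORDER of `ℤ` on its kernel: `ℤ` (`intSet`) and the kernel generators `{±2πi}`
(`kerGenSet`) are `∅`-definable (Kirby–Macintyre–Onshuus 2012, §2), and `0 ≤ m ⟺ m` is a sum of four squares
of integers (Lagrange).  Hence the SELECTOR
`S = {s ∈ E | ∃ t ∈ {±2πi}, ∀ m ∈ ℤ, s + tm ∈ E → 0 ≤ m}` ("no point of `E` strictly before `s` on its coset,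
in direction `t`") is `∅`-definable (`definable₁_selector`); it has at most one point per coset and sign (two
such points differ by `tm` with `0 ≤ m` and `0 ≤ −m`; `selector_subsingleton`), so it is finite
(`selector_finite`); and it contains `u + 2πi · min K` with `t = 2πi` (resp. `u + 2πi · max K` with
`t = −2πi`).  Since `expAcl` is closed under `+`, `·`, `−` and contains `2πi` and `ℤ`, `u ∈ expAcl`.

References: [KirbyMacintyreOnshuus2012] J. Kirby, A. Macintyre, A. Onshuus, *The algebraic numbers definable
in various exponential fields*, J. Inst. Math. Jussieu 11 (2012) 825–834, §2 (`ℤ`, `±2πi` parameter-free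
definable); [Marker2002] D. Marker, *Model Theory: An Introduction*, GTM 217, §1.3 (`acl`).
-/

noncomputable section

set_option linter.dupNamespace false

open Set FirstOrder

namespace Summit.Schanuel.Schanuel.Cruxes.MinimalCounterexampleInAcl.KernelArithmeticSelection

open Literature.ModelTheory.ExponentialFields
open Summit.Schanuel.Schanuel.Theorems.AclSubsetLogFreeCore.Negative

/-- Lagrange inside `ℂ_exp`: an integer `n` is a sum of four squares of elements of `intSet = ℤ` iff
`0 ≤ n` (`Nat.sum_four_squares`). [folklore] -/
theorem intCast_fourSquares_iff (n : ℤ) :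
    (∃ a, a ∈ intSet ∧ ∃ b, b ∈ intSet ∧ ∃ c, c ∈ intSet ∧ ∃ d, d ∈ intSet ∧
      (n : ℂ) = a * a + b * b + c * c + d * d) ↔ 0 ≤ n := by
  constructor
  · rintro ⟨a, ha, b, hb, c, hc, d, hd, h⟩
    obtain ⟨a, rfl⟩ := mem_intSet_iff.1 ha
    obtain ⟨b, rfl⟩ := mem_intSet_iff.1 hb
    obtain ⟨c, rfl⟩ := mem_intSet_iff.1 hc
    obtain ⟨d, rfl⟩ := mem_intSet_iff.1 hd
    have h' : n = a * a + b * b + c * c + d * d := by exact_mod_cast h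
    rw [h']
    nlinarith [mul_self_nonneg a, mul_self_nonneg b, mul_self_nonneg c, mul_self_nonneg d]
  · intro hn
    obtain ⟨a, b, c, d, h⟩ := Nat.sum_four_squares n.toNat
    refine ⟨a, mem_intSet_iff.2 ⟨a, by simp⟩, b, mem_intSet_iff.2 ⟨b, by simp⟩,
      c, mem_intSet_iff.2 ⟨c, by simp⟩, d, mem_intSet_iff.2 ⟨d, by simp⟩, ?_⟩
    have h1 : ((n.toNat : ℕ) : ℤ) = n := Int.toNat_of_nonneg hn
    have h2 : (n : ℂ) = ((n.toNat : ℕ) : ℂ) := by rw [← Int.cast_natCast, h1]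
    rw [h2, ← h]
    push_cast
    ring

/-- The one-sided selector `S = {s ∈ E | ∃ t ∈ {±2πi}, ∀ m ∈ ℤ, s + tm ∈ E → m ∈ ℕ}` (with `ℕ ⊆ ℤ` cut out by
four squares) is `∅`-definable in `ℂ_exp` whenever `E` is. [cite: KirbyMacintyreOnshuus2012, §2] -/
theorem definable₁_selector {E : Set ℂ} (hE : Set.Definable₁ (∅ : Set ℂ) Language.expRing E) :
    Set.Definable₁ (∅ : Set ℂ) Language.expRing
      {s : ℂ | s ∈ E ∧ ∃ t, t ∈ kerGenSet ∧ ∀ m, m ∈ intSet → s + t * m ∈ E →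
        ∃ a, a ∈ intSet ∧ ∃ b, b ∈ intSet ∧ ∃ c, c ∈ intSet ∧ ∃ d, d ∈ intSet ∧
          m = a * a + b * b + c * c + d * d} := by
  have h : (∅ : Set ℂ).Definable Language.expRing
      {v : Fin 1 → ℂ | v 0 ∈ E ∧ ∃ t, t ∈ kerGenSet ∧ ∀ m, m ∈ intSet → v 0 + t * m ∈ E →
        ∃ a, a ∈ intSet ∧ ∃ b, b ∈ intSet ∧ ∃ c, c ∈ intSet ∧ ∃ d, d ∈ intSet ∧
          m = a * a + b * b + c * c + d * d} := by
    refine definable_setOf_and_params ?_ ?_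
    · exact definable_mem_of_definable₁ hE (definableFun_proj_params _)
    · refine definable_setOf_exists_params (definable_setOf_and_params ?_ ?_)
      · exact definable_mem_kerGenSet (definableFun_proj_params _)
      · refine definable_setOf_forall_params
          (definable_setOf_imp_params ?_ (definable_setOf_imp_params ?_ ?_))
        · exact definable_mem_intSet (definableFun_proj_params _)
        · exact definable_mem_of_definable₁ hE
            (definableFun_add' (definableFun_proj_params _)
              (definableFun_mul' (definableFun_proj_params _) (definableFun_proj_params _)))
        · refine definable_setOf_exists_params (definable_setOf_and_params ?_ ?_)
          · exact definable_mem_intSet (definableFun_proj_params _)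
          · refine definable_setOf_exists_params (definable_setOf_and_params ?_ ?_)
            · exact definable_mem_intSet (definableFun_proj_params _)
            · refine definable_setOf_exists_params (definable_setOf_and_params ?_ ?_)
              · exact definable_mem_intSet (definableFun_proj_params _)
              · refine definable_setOf_exists_params (definable_setOf_and_params ?_ ?_)
                · exact definable_mem_intSet (definableFun_proj_params _)
                · exact definable_setOf_eq_params (definableFun_proj_params _)
                    (definableFun_add'
                      (definableFun_add'
                        (definableFun_add'
                          (definableFun_mul' (definableFun_proj_params _)
                            (definableFun_proj_params _))
                          (definableFun_mul' (definableFun_proj_params _)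
                            (definableFun_proj_params _)))
                        (definableFun_mul' (definableFun_proj_params _)
                          (definableFun_proj_params _)))
                      (definableFun_mul' (definableFun_proj_params _)
                        (definableFun_proj_params _)))
  unfold Set.Definable₁
  exact h

/-- On one coset of the kernel and for one sign `t ∈ {±2πi}`, at most one point `s ∈ E` has no point of `E`
strictly before it in direction `t`: two such points differ by `t·n` with `0 ≤ n` and `0 ≤ -n`. [folklore] -/
theorem selector_subsingleton {E : Set ℂ} {r t : ℂ} (ht : t ∈ kerGenSet) :
    Set.Subsingleton {s : ℂ | s ∈ E ∧ Complex.exp s = r ∧ ∀ n : ℤ, s + t * n ∈ E → 0 ≤ n} := by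
  rintro s₁ ⟨h1E, h1r, h1⟩ s₂ ⟨h2E, h2r, h2⟩
  obtain ⟨-, htgen⟩ : Complex.exp t = 1 ∧
      ∀ w : ℂ, Complex.exp w = 1 → ∃ m : ℂ, m ∈ intSet ∧ w = m * t := ht
  have hexp : Complex.exp (s₂ - s₁) = 1 := by
    rw [Complex.exp_sub, h1r, h2r]
    exact div_self (h1r ▸ Complex.exp_ne_zero s₁)
  obtain ⟨m, hm, hms⟩ := htgen _ hexp
  obtain ⟨n, rfl⟩ := mem_intSet_iff.1 hm
  have hn : 0 ≤ n := h1 n (by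
    rw [show s₁ + t * (n : ℂ) = s₂ by linear_combination -hms]
    exact h2E)
  have hn' : 0 ≤ -n := h2 (-n) (by
    rw [show s₂ + t * ((-n : ℤ) : ℂ) = s₁ by push_cast; linear_combination hms]
    exact h1E)
  have hn0 : (n : ℂ) = 0 := by exact_mod_cast (show n = 0 by omega)
  rw [hn0, zero_mul, sub_eq_zero] at hms
  exact hms.symm

/-- The one-sided selector of a set `E` lying on finitely many cosets of the kernel (`exp '' E` finite) is
FINITE: it is covered by the subsingletons of `selector_subsingleton`, indexed by `exp '' E × {±2πi}`.
[folklore] -/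
theorem selector_finite {E : Set ℂ} (hEfin : (Complex.exp '' E).Finite) :
    Set.Finite {s : ℂ | s ∈ E ∧ ∃ t, t ∈ kerGenSet ∧ ∀ m, m ∈ intSet → s + t * m ∈ E →
        ∃ a, a ∈ intSet ∧ ∃ b, b ∈ intSet ∧ ∃ c, c ∈ intSet ∧ ∃ d, d ∈ intSet ∧
          m = a * a + b * b + c * c + d * d} := by
  have hker : (kerGenSet : Set ℂ).Finite := by
    refine ((Set.finite_singleton (-(2 * ↑Real.pi * Complex.I : ℂ))).insert
      (2 * ↑Real.pi * Complex.I)).subset ?_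
    intro t ht
    rcases mem_kerGenSet_iff.1 ht with h | h
    · exact Or.inl h
    · exact Or.inr h
  refine ((hEfin.biUnion (t := fun r => ⋃ t ∈ kerGenSet,
      {s : ℂ | s ∈ E ∧ Complex.exp s = r ∧ ∀ n : ℤ, s + t * n ∈ E → 0 ≤ n})
    fun r _ => hker.biUnion fun t ht => (selector_subsingleton ht).finite).subset ?_)
  rintro s ⟨hsE, t, ht, hsel⟩
  simp only [Set.mem_iUnion, Set.mem_setOf_eq]
  exact ⟨Complex.exp s, ⟨s, hsE, rfl⟩, t, ht, hsE, rfl, fun n hn =>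
    (intCast_fourSquares_iff n).1 (hsel n (mem_intSet_iff.2 ⟨n, rfl⟩) hn)⟩

/-- **ONE-SIDED COSET SELECTOR.**  Let `E ⊆ ℂ` be `∅`-definable in `ℂ_exp` with `exp '' E` finite and
`u ∈ E`.  If the hit set `K = {k : ℤ | u + 2πik ∈ E}` of `u`'s coset is bounded below or above, then
`u ∈ acl^{ℂ_exp}(∅)`: the finite `∅`-definable selector (`definable₁_selector`, `selector_finite`) contains
`u + 2πi · min K` (direction `t = 2πi`), resp. `u + 2πi · max K` (direction `t = -2πi`), and `acl(∅)` is closed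
under `+`, `·`, `−` and contains `2πi`, `ℤ`. [cite: KirbyMacintyreOnshuus2012, §2] -/
theorem stub_selectorOneSided : ∀ (E : Set ℂ) (u : ℂ), Set.Definable₁ (∅ : Set ℂ) Literature.ModelTheory.ExponentialFields.Language.expRing E → (Complex.exp '' E).Finite → u ∈ E → (BddBelow {k : ℤ | u + 2 * ↑Real.pi * Complex.I * (k : ℂ) ∈ E} ∨ BddAbove {k : ℤ | u + 2 * ↑Real.pi * Complex.I * (k : ℂ) ∈ E}) → u ∈ Summit.Schanuel.Schanuel.Theorems.AclSubsetLogFreeCore.Negative.expAcl := by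
  intro E u hE hEfin huE hK
  -- a point of `E` with no point of `E` strictly before it (direction `t`) is selected, hence in `acl(∅)`
  have hsel : ∀ s t : ℂ, s ∈ E → t ∈ kerGenSet → (∀ n : ℤ, s + t * n ∈ E → 0 ≤ n) → s ∈ expAcl := by
    intro s t hsE ht hmin
    refine ⟨_, selector_finite hEfin, definable₁_selector hE, hsE, t, ht, fun m hm hmE => ?_⟩
    obtain ⟨n, rfl⟩ := mem_intSet_iff.1 hm
    exact (intCast_fourSquares_iff n).2 (hmin n hmE)
  -- the extremal hit of `u`'s coset
  have hK0 : (0 : ℤ) ∈ {k : ℤ | u + 2 * ↑Real.pi * Complex.I * (k : ℂ) ∈ E} := by simpa using huE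
  obtain ⟨s, t, k, hsE, ht, hmin, hu⟩ : ∃ (s t : ℂ) (k : ℤ), s ∈ E ∧ t ∈ kerGenSet ∧
      (∀ n : ℤ, s + t * n ∈ E → 0 ≤ n) ∧ u = s + -(2 * ↑Real.pi * Complex.I) * (k : ℂ) := by
    rcases hK with hbdd | hbdd
    · have hk := Int.csInf_mem ⟨0, hK0⟩ hbdd
      refine ⟨_, 2 * ↑Real.pi * Complex.I, _, hk, mem_kerGenSet_iff.2 (Or.inl rfl), fun n hn => ?_,
        by ring⟩
      have hmem : sInf {k : ℤ | u + 2 * ↑Real.pi * Complex.I * (k : ℂ) ∈ E} + n ∈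
          {k : ℤ | u + 2 * ↑Real.pi * Complex.I * (k : ℂ) ∈ E} := by
        simp only [Set.mem_setOf_eq, Int.cast_add]
        convert hn using 1
        ring
      have := csInf_le hbdd hmem
      omega
    · have hk := Int.csSup_mem ⟨0, hK0⟩ hbdd
      refine ⟨_, -(2 * ↑Real.pi * Complex.I), _, hk, mem_kerGenSet_iff.2 (Or.inr rfl), fun n hn => ?_,
        by ring⟩
      have hmem : sSup {k : ℤ | u + 2 * ↑Real.pi * Complex.I * (k : ℂ) ∈ E} - n ∈
          {k : ℤ | u + 2 * ↑Real.pi * Complex.I * (k : ℂ) ∈ E} := by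
        simp only [Set.mem_setOf_eq, Int.cast_sub]
        convert hn using 1
        ring
      have := le_csSup hbdd hmem
      omega
  rw [hu]
  exact add_mem_expAcl (hsel s t hsE ht hmin)
    (mul_mem_expAcl (neg_mem_expAcl two_pi_I_mem_expAcl) (intCast_mem_expAcl k))

end Summit.Schanuel.Schanuel.Cruxes.MinimalCounterexampleInAcl.KernelArithmeticSelection
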